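import Summits.KontsevichZagierPeriods.Zeta5Search.Certificates.RecordRayGrowthSharp
import HarnessLib

/-!
# ζ(5) search — certificates: the record dual series — III: the WINDOW inequality (tangent bounds keeping the cancellation)

HONEST FRAMING: systematic search; no irrationality claim unless certified.

OUR work (Summit side; certifier 2; CERTIFY-HOWTO §9 roadmap (D1), step "window"). By `RecordRayDualSeries` the
normalised term `T̂(μ)` of `F̃₇(b(a·n))` increases for `5(μ+1) ≤ 2n` and decreases for `20μ ≥ 9n`; its maximum lies in the
window `2n/5 − 1 ≤ μ ≤ 9n/20 + 1`, of width `Θ(n)`, where crude Lipschitz bounds of `x log x` lose `Θ(n log n)`. This file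
proves the first-order (tangent) bounds that keep the cancellation between the numerator and the seven denominator
binomials:

* `ent_shift_le` / `ent_shift_ge` — for `δ ≥ 0`: `δ·(log m − log(k+δ)) ≤ ent(m+δ, k+δ) − ent(m, k) ≤ δ·(log(m+δ) − log k)`
  (`ent(m,k) = m log m − k log k − (m−k) log(m−k)`, `RecordRay.ent`; from the tangent inequality `xlogx_sub_le_tangent`);
* `Hrec n μ` — the entropy combination of `log T̂(μ)`: `ent(41n+μ+1, μ) − Σ_j ent((41−β_j)n+μ+1, β_j n+μ)`, `β = (17,…,11)`;
* `Hrec_window_le` — for `0 < μ₀ ≤ μ ≤ μ₁`: `Hrec n μ ≤ Hrec n μ₀ + (μ − μ₀)·Λ(n, μ₀, μ₁)` with the EXPLICIT slope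
  `Λ = log((41n+1+μ₁)/μ₀) − Σ_j log(((41−β_j)n+μ₀+1)/(β_j n+μ₁))` (a number `≈ 0.11` for `μ₀ = 0.4n`, `μ₁ = 0.45n`: the window
  costs `≈ 0.006` nats, against `Θ(n log n)` for the crude bound).

NEXT (not here): `Λ ≤ Λ⁺` and `Hrec n (2n/5 − 1) ≤ n·ĥ(2/5) + O(log n)` by certified logarithms, Stirling on the window, the
chains and the partial-sum scheme ⇒ the two-sided exponential rate of `F̃₇(b(a·n))/Z_n` (sup `ĥ = −125.53659…`).
-/

noncomputable section

open Finset Real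

namespace Summit.KontsevichZagierPeriods.Zeta5Search.RecordRay

/-! ### First-order bounds for entropy shifts -/

/-- Lower tangent form: `(1 + log y)(x − y) ≤ x log x − y log y` (`x, y > 0`). -/
theorem xlogx_sub_ge_tangent {x y : ℝ} (hx : 0 < x) (hy : 0 < y) :
    (1 + Real.log y) * (x - y) ≤ x * Real.log x - y * Real.log y := by
  have h := xlogx_sub_le_tangent hy hx
  linarith

/-- **Upper shift bound**: for `δ ≥ 0`, `0 < k`, `0 < m`:
`ent(m+δ, k+δ) − ent(m,k) ≤ δ·(log(m+δ) − log k)` (the `(m−k)`-terms cancel; tangents at `m+δ` and at `k`). -/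
theorem ent_shift_le {m k δ : ℝ} (hm : 0 < m) (hk : 0 < k) (hδ : 0 ≤ δ) :
    ent (m + δ) (k + δ) - ent m k ≤ δ * (Real.log (m + δ) - Real.log k) := by
  unfold ent
  have h1 := xlogx_sub_le_tangent (show 0 < m + δ by linarith) hm      -- φ(m+δ) − φ(m) ≤ (1+log(m+δ))·δ
  have h2 := xlogx_sub_ge_tangent (show 0 < k + δ by linarith) hk      -- (1+log k)·δ ≤ φ(k+δ) − φ(k)
  have e : m + δ - (k + δ) = m - k := by ring
  rw [e]
  nlinarith

/-- **Lower shift bound**: for `δ ≥ 0`, `0 < k`, `0 < m`: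
`δ·(log m − log(k+δ)) ≤ ent(m+δ, k+δ) − ent(m,k)` (tangents at `m` and at `k+δ`). -/
theorem ent_shift_ge {m k δ : ℝ} (hm : 0 < m) (hk : 0 < k) (hδ : 0 ≤ δ) :
    δ * (Real.log m - Real.log (k + δ)) ≤ ent (m + δ) (k + δ) - ent m k := by
  unfold ent
  have h1 := xlogx_sub_ge_tangent (show 0 < m + δ by linarith) hm      -- (1+log m)·δ ≤ φ(m+δ) − φ(m)
  have h2 := xlogx_sub_le_tangent (show 0 < k + δ by linarith) hk      -- φ(k+δ) − φ(k) ≤ (1+log(k+δ))·δ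
  have e : m + δ - (k + δ) = m - k := by ring
  rw [e]
  nlinarith

/-! ### The entropy combination of the record dual term and its window inequality -/

/-- `H(n, μ) = ent(41n+μ+1, μ) − Σ_{j<7} ent((41−β_j)n+μ+1, β_j n+μ)`, `β_j = 17 − j`. -/
def Hrec (n μ : ℝ) : ℝ :=
  ent (41 * n + μ + 1) μ - ∑ j ∈ range 7, ent ((41 - (17 - (j : ℝ))) * n + μ + 1) ((17 - (j : ℝ)) * n + μ)

/-- The explicit slope of the window inequality. -/
def slopeΛ (n μ₀ μ₁ : ℝ) : ℝ :=
  (Real.log (41 * n + μ₁ + 1) - Real.log μ₀)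
    - ∑ j ∈ range 7, (Real.log ((41 - (17 - (j : ℝ))) * n + μ₀ + 1) - Real.log ((17 - (j : ℝ)) * n + μ₁))

/-- **Window inequality**: for `0 < n`, `0 < μ₀ ≤ μ ≤ μ₁`:  `H(n, μ) ≤ H(n, μ₀) + (μ − μ₀)·Λ(n, μ₀, μ₁)`. -/
theorem Hrec_window_le {n μ₀ μ μ₁ : ℝ} (hn : 0 < n) (h0 : 0 < μ₀) (h01 : μ₀ ≤ μ) (h1 : μ ≤ μ₁) :
    Hrec n μ ≤ Hrec n μ₀ + (μ - μ₀) * slopeΛ n μ₀ μ₁ := by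
  have hδ : 0 ≤ μ - μ₀ := by linarith
  -- numerator: ent(41n+μ+1, μ) − ent(41n+μ₀+1, μ₀) ≤ δ (log(41n+μ+1) − log μ₀) ≤ δ (log(41n+μ₁+1) − log μ₀)
  have hnum := ent_shift_le (m := 41 * n + μ₀ + 1) (k := μ₀) (δ := μ - μ₀) (by linarith) h0 hδ
  have hnum' : (μ - μ₀) * (Real.log (41 * n + μ₀ + 1 + (μ - μ₀)) - Real.log μ₀) ≤
      (μ - μ₀) * (Real.log (41 * n + μ₁ + 1) - Real.log μ₀) := by
    apply mul_le_mul_of_nonneg_left _ hδ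
    have := Real.log_le_log (by linarith : 0 < 41 * n + μ₀ + 1 + (μ - μ₀)) (by linarith : 41 * n + μ₀ + 1 + (μ - μ₀) ≤ 41 * n + μ₁ + 1)
    linarith
  have en : 41 * n + μ₀ + 1 + (μ - μ₀) = 41 * n + μ + 1 := by ring
  have ek : μ₀ + (μ - μ₀) = μ := by ring
  rw [en, ek] at hnum
  rw [en] at hnum'
  -- denominators: ent_j(μ) − ent_j(μ₀) ≥ δ (log M_j(μ₀) − log K_j(μ)) ≥ δ (log M_j(μ₀) − log K_j(μ₁))
  have hden : ∀ j ∈ range 7,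
      (μ - μ₀) * (Real.log ((41 - (17 - (j : ℝ))) * n + μ₀ + 1) - Real.log ((17 - (j : ℝ)) * n + μ₁)) ≤
        ent ((41 - (17 - (j : ℝ))) * n + μ + 1) ((17 - (j : ℝ)) * n + μ)
          - ent ((41 - (17 - (j : ℝ))) * n + μ₀ + 1) ((17 - (j : ℝ)) * n + μ₀) := by
    intro j hj
    have hj7 : (j : ℝ) < 7 := by exact_mod_cast mem_range.1 hj
    have hj0 : (0 : ℝ) ≤ j := Nat.cast_nonneg j
    have hM : 0 < (41 - (17 - (j : ℝ))) * n + μ₀ + 1 := by nlinarith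
    have hK : 0 < (17 - (j : ℝ)) * n + μ₀ := by nlinarith
    have h := ent_shift_ge (m := (41 - (17 - (j : ℝ))) * n + μ₀ + 1) (k := (17 - (j : ℝ)) * n + μ₀) (δ := μ - μ₀) hM hK hδ
    have eM : (41 - (17 - (j : ℝ))) * n + μ₀ + 1 + (μ - μ₀) = (41 - (17 - (j : ℝ))) * n + μ + 1 := by ring
    have eK : (17 - (j : ℝ)) * n + μ₀ + (μ - μ₀) = (17 - (j : ℝ)) * n + μ := by ring
    rw [eM, eK] at h
    have hmono : Real.log ((17 - (j : ℝ)) * n + μ) ≤ Real.log ((17 - (j : ℝ)) * n + μ₁) :=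
      Real.log_le_log (by nlinarith) (by linarith)
    have hmul : (μ - μ₀) * (Real.log ((41 - (17 - (j : ℝ))) * n + μ₀ + 1) - Real.log ((17 - (j : ℝ)) * n + μ₁)) ≤
        (μ - μ₀) * (Real.log ((41 - (17 - (j : ℝ))) * n + μ₀ + 1) - Real.log ((17 - (j : ℝ)) * n + μ)) := by
      apply mul_le_mul_of_nonneg_left _ hδ; linarith
    linarith
  have hsum := sum_le_sum hden
  rw [← mul_sum] at hsum
  have hsplit : (∑ j ∈ range 7, (ent ((41 - (17 - (j : ℝ))) * n + μ + 1) ((17 - (j : ℝ)) * n + μ)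
      - ent ((41 - (17 - (j : ℝ))) * n + μ₀ + 1) ((17 - (j : ℝ)) * n + μ₀))) =
      (∑ j ∈ range 7, ent ((41 - (17 - (j : ℝ))) * n + μ + 1) ((17 - (j : ℝ)) * n + μ))
        - ∑ j ∈ range 7, ent ((41 - (17 - (j : ℝ))) * n + μ₀ + 1) ((17 - (j : ℝ)) * n + μ₀) := sum_sub_distrib _ _
  rw [hsplit] at hsum
  unfold Hrec slopeΛ
  rw [mul_sub]
  linarith [hsum, hnum, hnum']

end Summit.KontsevichZagierPeriods.Zeta5Search.RecordRay
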